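import Literature.MathematicalPhysics.QuantumFieldTheory.Balaban1983to89.B5G183RateL2Op
import Literature.MathematicalPhysics.QuantumFieldTheory.Balaban1983to89.B5G183RateObstruction
import Literature.Computability.QuantumComplexity.SolovayKitaev.Basic

/-!
# Bałaban [CMP 95 (1984)] (1.83)/(1.89) at `U = 1`, ORDER TWO: NO uniform `ℓ²`-operator eta-RATE —
the operator-level NO-GO theorem for the naive order-two residual (`¬ OrderTwoOpRateResidual d a C` for
every `C`, `d ≥ 2`, `a > 0`)

HONEST FRAMING (cell `pub-balaban`, T⁴ programme, estimate NE2 = U1a «η-rate, linear theory»).  This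
module is a NEGATIVE bookkeeping result about the scheme of `B5G183RateL2Op` / `B5G183RateL2Asm` for
Bałaban's operator `G` of (1.83) ([Balaban1984PropagatorsI] p. 31) on a FINITE torus with lattice spacing
`η = 1/n` and the trivial background `U = 1`, fibrewise at a fixed NONZERO reduced momentum `p′`.  For the
ORDER-ONE items `∇G`, `G∇*` of Prop. 1.1 (1.89) p. 33 that scheme gives the rate `Casm(d,a)/N` in the
`ℓ²`-operator norm of the fibre, uniformly in the class (`B5G183RateL2Asm.orderOneOpRateResidualL_holds`).
HERE it is shown that the SAME statement shape for the ORDER-TWO item `∇G∇*` of (1.89) — typed below as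
`OrderTwoOpRateResidual d a C`: a uniform-in-the-class bound `C/N` for the `ℓ²`-operator norm of the planted
difference of the sandwiches `D_{∂_ν} G D^*_{∂_{ν′}}` between the levels `N` and `RN` — is FALSE for every
constant `C` (`not_orderTwoOpRateResidual`, `no_orderTwoOpRate`), by an explicit witness (below).  This is
the operator-level form of the symbol-level obstruction `B5G183RateObstruction.order_two_weight_no_rate`
(free-diagonal weights `4/7` vs `2/3` at one physical momentum), upgraded by (a) «an entry is bounded by the
operator norm» and (b) the x-block / rank-one corrections of (1.83) at that entry being `O(N⁻²)`.  It says
only that an order-two η-rate, if wanted, must be posed in another norm or regime (class cut-off, mixed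
order, after composition with averaging operators — not decided here).  Nothing here is infinite-volume, a
mass gap, uniform in a coupling, a statement about `U ≠ 1`, or progress on any Clay problem or on the
summit statement of this programme; the uniform order-two BOUND of (1.89) (b05's reviewed
`B5Prop11Fiber.opNorm_D_G_D_le`) is untouched — only its naive RATE analogue fails.  All theorems
`[folklore]` with OUR constants; `[cite: …]` tags locate TEXT, never a proof.

WHAT IS PRINTED (renders read as images by this seat: [Balaban1984PropagatorsI] pp. 31, 32, 33; [King1986]
pp. 672, 673).  Bałaban p. 33: «Proposition 1.1. The operator G is a symmetric operator on L²(T_η) and ‖GJ‖,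
‖∇GJ‖, ‖G∇*J‖, ‖∇G∇*J‖, ‖∇∇GJ‖, ‖G∇*∇*J‖ ≤ γ₀⁻¹‖J‖, (1.89) with a positive constant γ₀ independent of k,
T_η, and depending on d only (if we put a = 1). This implies the bound from below: Δ_a = G⁻¹ ≥ γ₀(Δ + I).
(1.90)»; p. 32: «It is bounded also when differentiated two times at most.»  King p. 672: «To analyze the
m = 0 term in (4.19), we successively replace each factor by the corresponding one … and bound the error. We
must always be careful to keep enough negative powers of momentum so that» (the alias sums converge), with
the legends of (4.22) «… ≤ C for α < 1.» and (4.23) «≤ CL^{−γk} for α + γ < 1».  NO η-rate for `G` is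
printed by Bałaban, and King's rates are for the scalar averaging kernels: the statement refuted here is an
internally-typed candidate residual, not a printed claim — its refutation corrects OUR scheme, not the papers.
The typed (1.83) fibre is b05's `B5Prop11Fiber.balabanFiber`; its entries in King's variables are
`B5G183RateOp.G_entry` / `Gfor` (free diagonal `Δ(q_k)⁻¹`, x-block `xEnt`, rank-one block `rEnt`); the
weight is b05's `dSym n k p′ ν = ∂^{(n)}_ν(p′ + 2πk)`; planting is `B5G183RateOp.plant` (King's pairing
`ι = B5Hk163Rate.iota`); the witness momentum / fibre / class are `B5G183RateObstruction.qWit/sWit/kWit`.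

WHAT IS TYPED HERE (hypotheses `μ₁ ≠ μ₂` (so `d ≥ 2`), `0 < a` only):
 * §1 `OrderTwoOpRateResidual d a C` — the naive order-two analogue of
   `B5G183RateL2Op.OrderOneOpRateResidualL` (same binders; sandwich weights `∂_ν`, `∂_{ν′}`);
 * §2 generic lemmas (an entry is bounded by the operator norm: the tree's
   `SolovayKitaev.norm_apply_le_norm`): `aliasWeight_le_one` (King's (4.20) weight
   `≤ 1` on the zone), `Gfor_diag`, `weight_mul_diag`, and `junk_le` (the weighted x/r corrections of a
   diagonal entry are `≤ ((4d+a)/a·Bb² + (4d/γ₀)·Bx²)/L²` when `|w|² ≤ L²`, `xM ≤ Bx/L²`, `bM ≤ Bb/L²`);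
 * §3 the witness (`R = 2`, level `N = 6m+3`, fibre `p′ = π e_{μ₁}`, class `kWit` with
   `q = (πN) e_{μ₁} + (2πN/3) e_{μ₂}`, directions `(μ₁, μ₁)`): no folding (`symmShift_kWit`,
   `symmAlias_kWit`, `iota_kWit`), the main terms `main_one = 4/7`, `main_two = 2/3`, the majorants
   `xM_w_le`, `bM_w_le` (`≤ CXa/(πN)²`, `CBa/(πN)²`), the matrix `Xw` and its entry `Xw_entry`;
 * §4 `Cjunk d a`, `junk_one_le` / `junk_two_le` (`≤ Cjunk/N²`), `numeric_core`, and the theorems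
   `not_orderTwoOpRateResidual (hne : μ₁ ≠ μ₂) (a) (ha : 0 < a) (C) : ¬ OrderTwoOpRateResidual d a C`,
   `no_orderTwoOpRate : ¬ ∃ C, OrderTwoOpRateResidual d a C`.
 NO conditional of the cell is used or mentioned in any signature (no BetaPertH / (B) / (B^μ)); `U = 1`.

WHAT IS NOT CLAIMED: (i) that the order-two items of (1.89) have no η-rate in ANY sense — only the uniform
`ℓ²((ℤ/RN)^d × Fin d)`-operator-norm rate of the planted difference, uniform in the class, fails; rates with
a class cut-off `|k|_∞ ≤ Λ` (constant `C(Λ)`), of mixed order, or after composition with averaging operators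
are neither asserted nor denied; (ii) anything about `d = 1` (the witness needs two directions);
(iii) `p′`-derivatives, `∫dp′` / the identification with Bałaban's `L²(T_η)` operators, position-space
decay, `U ≠ 1`, constants (`Cjunk` is a crude closed form); (iv) any claim about print beyond the located
quotations above.
-/

noncomputable section

namespace Literature.MathematicalPhysics.QuantumFieldTheory.Balaban1983to89.B5G183RateObstructionOp

open scoped BigOperators ComplexConjugate Matrix.Norms.L2Operator
open Finset Complex
open Literature.MathematicalPhysics.QuantumFieldTheory.Balaban1983to89.B4Strip
open Literature.MathematicalPhysics.QuantumFieldTheory.Balaban1983to89.B5Prop11Leaves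
open Literature.MathematicalPhysics.QuantumFieldTheory.Balaban1983to89.B5Prop11Fiber
open Literature.MathematicalPhysics.QuantumFieldTheory.Balaban1983to89.B5Prop11Bound
open Literature.MathematicalPhysics.QuantumFieldTheory.Balaban1983to89.B5Hk163Rate
open Literature.MathematicalPhysics.QuantumFieldTheory.Balaban1983to89.B5Hk163RateSum
open Literature.MathematicalPhysics.QuantumFieldTheory.Balaban1983to89.B5G183Rate
open Literature.MathematicalPhysics.QuantumFieldTheory.Balaban1983to89.B5G183RateSum
open Literature.MathematicalPhysics.QuantumFieldTheory.Balaban1983to89.B5G183RateOp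
open Literature.MathematicalPhysics.QuantumFieldTheory.Balaban1983to89.B5G183RateL2
open Literature.MathematicalPhysics.QuantumFieldTheory.Balaban1983to89.B5G183RateObstruction
open Literature.MathematicalPhysics.QuantumFieldTheory.King1986
open Literature.Computability.QuantumComplexity.SolovayKitaev (norm_apply_le_norm)

variable {d : ℕ}

/-! ## §1 The naive order-two residual statement (the shape that FAILS) [folklore] -/

/-- **The naive ORDER-TWO analogue of `B5G183RateL2Op.OrderOneOpRateResidualL`**: a uniform-in-the-class
`ℓ²((ℤ/RN)^d × Fin d)`-operator-norm η-rate `C/N` for the planted difference of the order-two sandwiches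
`D_{∂_ν} G D_{∂_{ν′}}^*` (the fibre form of the item `∇G∇*` of (1.89)) between the levels `N` and `RN`, at
`U = 1`, on every fibre `p′ ≠ 0` of the zone. THIS STATEMENT IS REFUTED BELOW (`not_orderTwoOpRateResidual`)
for every `d ≥ 2`, `a > 0` and every constant `C`: it is typed here only to make the obstruction precise.
[cite: Balaban1984PropagatorsI, Prop. 1.1 (1.89) p.33 (the uniform bound whose η-rate is asked)] [folklore] -/
def OrderTwoOpRateResidual (d : ℕ) (a C : ℝ) : Prop :=
  ∀ (N R : ℕ) [NeZero N] [NeZero R] (hN : 1 ≤ N) (hRN : 1 ≤ R * N) (ha : 0 < a) (s : Fin d → ℝ)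
    (hs : ∀ ν, |s ν| ≤ Real.pi) (hs0 : s ≠ 0) (ν ν' : Fin d), 1 ≤ R →
    ‖sandwich (fun k => dSym (R * N) k s ν) (fun k => dSym (R * N) k s ν')
          (balabanFiber (R * N) hRN a ha s hs hs0).G
        - plant R s (sandwich (fun k => dSym N k s ν) (fun k => dSym N k s ν')
          (balabanFiber N hN a ha s hs hs0).G)‖ ≤ C / N

/-! ## §2 Generic lemmas [folklore] -/

/-- the alias weight of King's (4.20)/(4.23) is at most one on the zone `|p′_μ| ≤ π`. [cite: King1986, (4.20) p.672]
[folklore] -/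
theorem aliasWeight_le_one {p : Fin d → ℝ} (hp : ∀ μ, |p μ| ≤ Real.pi) (j : Fin d → ℤ) :
    aliasWeight p j ≤ 1 := by
  unfold aliasWeight
  refine Finset.prod_le_one (fun μ _ => ?_) (fun μ _ => ?_)
  · split_ifs
    · exact zero_le_one
    · exact div_nonneg (abs_nonneg _) (abs_nonneg _)
  · split_ifs with hj
    · exact le_rfl
    · have hj1 : (1 : ℝ) ≤ |(j μ : ℝ)| := by
        rw [← Int.cast_abs]; exact_mod_cast Int.one_le_abs hj
      have hden : Real.pi ≤ |p μ + 2 * Real.pi * j μ| := by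
        have h1 : |2 * Real.pi * (j μ : ℝ)| = 2 * Real.pi * |(j μ : ℝ)| := by
          rw [abs_mul, abs_of_pos (by positivity : (0 : ℝ) < 2 * Real.pi)]
        have h2 : 2 * Real.pi * 1 ≤ 2 * Real.pi * |(j μ : ℝ)| :=
          mul_le_mul_of_nonneg_left hj1 (by positivity)
        have h3 := abs_sub_abs_le_abs_sub (2 * Real.pi * (j μ : ℝ)) (-(p μ))
        rw [abs_neg, sub_neg_eq_add, add_comm] at h3
        have := hp μ
        linarith
      by_cases h0 : p μ + 2 * Real.pi * j μ = 0
      · rw [h0, abs_zero, div_zero]; exact zero_le_one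
      · rw [div_le_one (abs_pos.mpr h0)]
        exact (hp μ).trans hden

section Witness

variable {μ₁ μ₂ : Fin d}

/-- at the witness fibre/class no coordinate is folded: `symmShift = 0` (the alias `p′ + 2πk` has coordinates
`πN`, `2πN/3`, `0`, none `> πN`). [folklore] -/
theorem symmShift_kWit (m : ℕ) (hne : μ₁ ≠ μ₂) (ν : Fin d) :
    symmShift (6 * m + 3) (kWit m (6 * m + 3) le_rfl μ₁ μ₂) (sWit μ₁) ν = 0 := by
  unfold symmShift
  have h : shiftr (6 * m + 3) (kWit m (6 * m + 3) le_rfl μ₁ μ₂) (sWit μ₁) ν = qWit (6 * m + 3) μ₁ μ₂ ν :=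
    (congrFun (qWit_eq_shiftr m hne) ν).symm
  rw [h, if_neg]
  have hN : (0 : ℝ) ≤ Real.pi * ((6 * m + 3 : ℕ) : ℝ) := by positivity
  unfold qWit
  split_ifs
  · exact lt_irrefl _
  · push_cast; nlinarith [Real.pi_pos]
  · exact not_lt.mpr hN

/-- hence the symmetric representative of the witness class IS the witness momentum `qWit`. [folklore] -/
theorem symmAlias_kWit (m : ℕ) (hne : μ₁ ≠ μ₂) :
    symmAlias (6 * m + 3) (kWit m (6 * m + 3) le_rfl μ₁ μ₂) (sWit μ₁) = qWit (6 * m + 3) μ₁ μ₂ := by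
  funext ν
  unfold symmAlias
  rw [symmShift_kWit m hne ν, ← congrFun (qWit_eq_shiftr m hne) ν]
  simp

/-- and its canonical lift `ι₂` to level `2N` is the level-`2N` witness class (same integer coordinates).
[folklore] -/
theorem iota_kWit (m : ℕ) (hne : μ₁ ≠ μ₂) :
    iota 2 (kWit m (6 * m + 3) le_rfl μ₁ μ₂) (sWit μ₁) = kWit m (2 * (6 * m + 3)) (by omega) μ₁ μ₂ := by
  funext ν
  apply Fin.ext
  simp only [iota, symmShift_kWit m hne ν, mul_zero, add_zero]
  unfold kWit
  split_ifs <;> rfl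

/-- the witness class is not the zero class. [folklore] -/
theorem kWit_ne_zero (m n : ℕ) [NeZero n] (hn : 6 * m + 3 ≤ n) (μ₁ μ₂ : Fin d) :
    kWit m n hn μ₁ μ₂ ≠ 0 := by
  intro h
  have := congrFun h μ₁
  simp [kWit, Fin.ext_iff] at this

/-- the witness momentum has sup norm `≥ πN` (its `μ₁`-coordinate is `πN`). [folklore] -/
theorem pi_mul_le_norm_qWit (N : ℕ) (μ₁ μ₂ : Fin d) : Real.pi * N ≤ ‖qWit N μ₁ μ₂‖ := by
  have h := norm_le_pi_norm (qWit N μ₁ μ₂) μ₁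
  have h1 : qWit N μ₁ μ₂ μ₁ = Real.pi * N := by simp [qWit]
  rw [h1, Real.norm_eq_abs, abs_of_nonneg (by positivity)] at h
  exact h

end Witness

/-- the diagonal entry of (1.83) at U = 1: `G(k,k)_{μμ} = (Δ(q_k)⁻¹ − xEnt(k,k)) + rEnt_{μμ}(k,k)`. [folklore] -/
theorem Gfor_diag {n : ℕ} [NeZero n] (a : ℝ) (s : Fin d → ℝ) (μ : Fin d) (K : Fin d → Fin n) :
    Gfor n a s μ μ K K
      = ((((DeltaXir n 0 (symmAlias n K s) : ℝ) : ℂ))⁻¹ - xEnt n a μ s K K) + rEnt n a μ μ s K K := by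
  simp [Gfor]

/-- `w·((Δ⁻¹ − x) + r)·w̄ = |w|²·Δ⁻¹ + |w|²·(r − x)`. [folklore] -/
theorem weight_mul_diag (w Di x r : ℂ) :
    w * ((Di - x) + r) * conj w = ((‖w‖ ^ 2 : ℝ) : ℂ) * Di + ((‖w‖ ^ 2 : ℝ) : ℂ) * (r - x) := by
  have h := Complex.mul_conj' w
  push_cast
  rw [← h]
  ring

/-- **the weighted junk of a diagonal entry is `O(L⁻²)`**: if `|w|² ≤ L²`, `xM_K ≤ Bx/L²`, `bM_K ≤ Bb/L²` then
`‖|w|²·(rEnt(K,K) − xEnt(K,K))‖ ≤ ((4d+a)/a·Bb² + (4d/γ₀)·Bx²)/L²` (`cB ≤ (4d+a)/a`, `cX ≤ Δ₀/γ₀ ≤ 4d/γ₀`).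
[folklore] -/
theorem junk_le {n : ℕ} [NeZero n] (hn : 1 ≤ n) (a : ℝ) (ha : 0 < a) {s : Fin d → ℝ}
    (hs : ∀ ν, |s ν| ≤ Real.pi) (ν₀ : Fin d) (hν₀ : s ν₀ ≠ 0) (μ : Fin d) (K : Fin d → Fin n) (w : ℂ)
    {L Bx Bb : ℝ} (hL : 0 < L) (hw : ‖w‖ ^ 2 ≤ L ^ 2) (hBx : 0 ≤ Bx) (hBb : 0 ≤ Bb)
    (hx : xM n s μ K ≤ Bx / L ^ 2) (hb : bM n a s μ K ≤ Bb / L ^ 2) :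
    ‖((‖w‖ ^ 2 : ℝ) : ℂ) * (rEnt n a μ μ s K K - xEnt n a μ s K K)‖
      ≤ ((4 * d + a) / a * Bb ^ 2 + 4 * d / T4GaugeActionRate.gam0 d * Bx ^ 2) / L ^ 2 := by
  have hxE := norm_xEnt_le hn a ha μ hs ν₀ hν₀ K K
  have hrE := norm_rEnt_le hn a ha μ μ hs ν₀ hν₀ K K
  have hcX := cX_le hn a ha μ hs ν₀ hν₀
  have hcB := cB_le hn a ha hs ν₀ hν₀
  have hD4 : Delta1r 0 s ≤ 4 * d := Delta1r_le s
  have hγ := T4GaugeActionRate.gam0_pos d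
  have hxM0 := xM_nonneg s μ K
  have hbM0 := bM_nonneg ha s μ K
  have hcX' : cX n a μ s ≤ 4 * d / T4GaugeActionRate.gam0 d :=
    hcX.trans (div_le_div_of_nonneg_right hD4 hγ.le)
  have hcB' : cB n a s ≤ (4 * d + a) / a := hcB.1.trans hcB.2
  rw [norm_mul, Complex.norm_real, Real.norm_eq_abs, abs_of_nonneg (sq_nonneg _)]
  have h1 : ‖rEnt n a μ μ s K K - xEnt n a μ s K K‖
      ≤ (4 * d + a) / a * (Bb / L ^ 2) * (Bb / L ^ 2)
        + 4 * d / T4GaugeActionRate.gam0 d * (Bx / L ^ 2) * (Bx / L ^ 2) := by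
    refine (norm_sub_le _ _).trans (add_le_add ?_ ?_)
    · exact hrE.trans (mul_le_mul (mul_le_mul hcB' hb hbM0 (by positivity)) hb hbM0 (by positivity))
    · exact hxE.trans (mul_le_mul (mul_le_mul hcX' hx hxM0 (by positivity)) hx hxM0 (by positivity))
  calc ‖w‖ ^ 2 * ‖rEnt n a μ μ s K K - xEnt n a μ s K K‖
      ≤ L ^ 2 * ((4 * d + a) / a * (Bb / L ^ 2) * (Bb / L ^ 2)
        + 4 * d / T4GaugeActionRate.gam0 d * (Bx / L ^ 2) * (Bx / L ^ 2)) :=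
        mul_le_mul hw h1 (norm_nonneg _) (by positivity)
    _ = ((4 * d + a) / a * Bb ^ 2 + 4 * d / T4GaugeActionRate.gam0 d * Bx ^ 2) / L ^ 2 := by
        field_simp

/-! ## §3 The witness: fibre `p′ = π e_{μ₁}`, level `N = 6m+3`, class `kWit`, `R = 2`, entry `((ιk, μ₁), (ιk, μ₁))`
[folklore] -/

section Main

variable {μ₁ μ₂ : Fin d}

/-- `|∂^{(N)}_{μ₁}(q)|²` at the witness class equals `Sxir N (qWit_{μ₁})`. [folklore] -/
theorem normSq_w_one (m : ℕ) [NeZero (6 * m + 3)] (hne : μ₁ ≠ μ₂) :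
    ‖dSym (6 * m + 3) (kWit m (6 * m + 3) le_rfl μ₁ μ₂) (sWit μ₁) μ₁‖ ^ 2
      = Sxir (6 * m + 3) (qWit (6 * m + 3) μ₁ μ₂ μ₁) := by
  rw [norm_dSym_sq, ← congrFun (qWit_eq_shiftr m hne) μ₁]

/-- `|∂^{(2N)}_{μ₁}(q)|²` at the lifted witness class equals `Sxir (2N) (qWit_{μ₁})`. [folklore] -/
theorem normSq_w_two (m : ℕ) [NeZero (6 * m + 3)] (hne : μ₁ ≠ μ₂) :
    ‖dSym (2 * (6 * m + 3)) (iota 2 (kWit m (6 * m + 3) le_rfl μ₁ μ₂) (sWit μ₁)) (sWit μ₁) μ₁‖ ^ 2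
      = Sxir (2 * (6 * m + 3)) (qWit (6 * m + 3) μ₁ μ₂ μ₁) := by
  rw [norm_dSym_sq, iota_kWit m hne, ← congrFun (qWit_eq_shiftr_double m hne) μ₁]

/-- both weights are `≤ (πN)²` (`Sxir n x ≤ x²` at `x = qWit_{μ₁} = πN`). [folklore] -/
theorem Sxir_qWit_le (n m : ℕ) (μ₁ μ₂ : Fin d) :
    Sxir n (qWit (6 * m + 3) μ₁ μ₂ μ₁) ≤ (Real.pi * ((6 * m + 3 : ℕ) : ℝ)) ^ 2 := by
  have h1 : qWit (6 * m + 3) μ₁ μ₂ μ₁ = Real.pi * ((6 * m + 3 : ℕ) : ℝ) := by simp [qWit]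
  rw [h1]
  exact Sxir_le _ _

/-- **level `N` main term `= 4/7`.** [folklore] -/
theorem main_one (m : ℕ) [NeZero (6 * m + 3)] (hne : μ₁ ≠ μ₂) :
    ‖dSym (6 * m + 3) (kWit m (6 * m + 3) le_rfl μ₁ μ₂) (sWit μ₁) μ₁‖ ^ 2
        / DeltaXir (6 * m + 3) 0 (symmAlias (6 * m + 3) (kWit m (6 * m + 3) le_rfl μ₁ μ₂) (sWit μ₁))
      = 4 / 7 := by
  rw [normSq_w_one m hne, symmAlias_kWit m hne]
  exact weight_level (6 * m + 3) (by omega) hne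

/-- **level `2N` main term `= 2/3`.** [folklore] -/
theorem main_two (m : ℕ) [NeZero (6 * m + 3)] (hne : μ₁ ≠ μ₂) :
    ‖dSym (2 * (6 * m + 3)) (iota 2 (kWit m (6 * m + 3) le_rfl μ₁ μ₂) (sWit μ₁)) (sWit μ₁) μ₁‖ ^ 2
        / DeltaXir (2 * (6 * m + 3)) 0
          (symmAlias (2 * (6 * m + 3)) (iota 2 (kWit m (6 * m + 3) le_rfl μ₁ μ₂) (sWit μ₁)) (sWit μ₁))
      = 2 / 3 := by
  rw [normSq_w_two m hne, symmAlias_iota (by omega) _ (sWit_zone_ne_zero μ₁).1, symmAlias_kWit m hne]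
  exact weight_level_double (6 * m + 3) (by omega) hne

/-- the x-majorant of the lifted class equals that of the class. [folklore] -/
theorem xM_iota_w (m : ℕ) [NeZero (6 * m + 3)] (μ : Fin d) :
    xM (2 * (6 * m + 3)) (sWit μ₁) μ (iota 2 (kWit m (6 * m + 3) le_rfl μ₁ μ₂) (sWit μ₁))
      = xM (6 * m + 3) (sWit μ₁) μ (kWit m (6 * m + 3) le_rfl μ₁ μ₂) := by
  unfold xM
  rw [symmAlias_iota (by omega) _ (sWit_zone_ne_zero μ₁).1]

/-- the bracket majorant of the lifted class equals that of the class. [folklore] -/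
theorem bM_iota_w (m : ℕ) [NeZero (6 * m + 3)] (hne : μ₁ ≠ μ₂) (a : ℝ) (μ : Fin d) :
    bM (2 * (6 * m + 3)) a (sWit μ₁) μ (iota 2 (kWit m (6 * m + 3) le_rfl μ₁ μ₂) (sWit μ₁))
      = bM (6 * m + 3) a (sWit μ₁) μ (kWit m (6 * m + 3) le_rfl μ₁ μ₂) := by
  unfold bM
  rw [if_neg (kWit_ne_zero m _ le_rfl μ₁ μ₂), if_neg, symmAlias_iota (by omega) _ (sWit_zone_ne_zero μ₁).1]
  rw [iota_kWit m hne]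
  exact kWit_ne_zero m _ _ μ₁ μ₂

/-- `xM` of the witness class `≤ CXa/(πN)²`. [folklore] -/
theorem xM_w_le (m : ℕ) [NeZero (6 * m + 3)] (hne : μ₁ ≠ μ₂) (μ : Fin d) :
    xM (6 * m + 3) (sWit μ₁) μ (kWit m (6 * m + 3) le_rfl μ₁ μ₂)
      ≤ CXa d / (Real.pi * ((6 * m + 3 : ℕ) : ℝ)) ^ 2 := by
  have hs := (sWit_zone_ne_zero μ₁).1
  have hk : jOf (6 * m + 3) (kWit m (6 * m + 3) le_rfl μ₁ μ₂) (sWit μ₁) ≠ 0 := fun h =>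
    kWit_ne_zero m _ le_rfl μ₁ μ₂ ((jOf_eq_zero_iff (by omega) hs _).mp h)
  have h := xM_le_W_div_sq hs μ hk
  rw [symmAlias_kWit m hne] at h
  have hW := aliasWeight_le_one hs (jOf (6 * m + 3) (kWit m (6 * m + 3) le_rfl μ₁ μ₂) (sWit μ₁))
  have hq := pi_mul_le_norm_qWit (6 * m + 3) μ₁ μ₂
  have hπN : 0 < Real.pi * ((6 * m + 3 : ℕ) : ℝ) := by positivity
  refine h.trans (div_le_div₀ (CXa_nonneg d) ?_ (by positivity) ?_)
  · simpa using mul_le_mul_of_nonneg_left hW (CXa_nonneg d)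
  · exact pow_le_pow_left₀ hπN.le hq 2

/-- `bM` of the witness class `≤ CBa/(πN)²`. [folklore] -/
theorem bM_w_le (m : ℕ) [NeZero (6 * m + 3)] (hne : μ₁ ≠ μ₂) (a : ℝ) (μ : Fin d) :
    bM (6 * m + 3) a (sWit μ₁) μ (kWit m (6 * m + 3) le_rfl μ₁ μ₂)
      ≤ CBa d / (Real.pi * ((6 * m + 3 : ℕ) : ℝ)) ^ 2 := by
  have hs := (sWit_zone_ne_zero μ₁).1
  have hk : jOf (6 * m + 3) (kWit m (6 * m + 3) le_rfl μ₁ μ₂) (sWit μ₁) ≠ 0 := fun h =>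
    kWit_ne_zero m _ le_rfl μ₁ μ₂ ((jOf_eq_zero_iff (by omega) hs _).mp h)
  have h := bM_le_W_div_sq (by omega) a hs μ hk
  rw [symmAlias_kWit m hne] at h
  have hW := aliasWeight_le_one hs (jOf (6 * m + 3) (kWit m (6 * m + 3) le_rfl μ₁ μ₂) (sWit μ₁))
  have hq := pi_mul_le_norm_qWit (6 * m + 3) μ₁ μ₂
  have hπN : 0 < Real.pi * ((6 * m + 3 : ℕ) : ℝ) := by positivity
  refine h.trans (div_le_div₀ (CBa_nonneg d) ?_ (by positivity) ?_)
  · simpa using mul_le_mul_of_nonneg_left hW (CBa_nonneg d)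
  · exact pow_le_pow_left₀ hπN.le hq 2

/-- the planted order-two difference at the witness: `R = 2`, level `N = 6m+3`, fibre `p′ = π e_{μ₁}`,
directions `(μ₁, μ₁)`. [folklore] -/
def Xw (m : ℕ) [NeZero (6 * m + 3)] (μ₁ : Fin d) (a : ℝ) (ha : 0 < a) :
    Matrix ((Fin d → Fin (2 * (6 * m + 3))) × Fin d) ((Fin d → Fin (2 * (6 * m + 3))) × Fin d) ℂ :=
  sandwich (fun k => dSym (2 * (6 * m + 3)) k (sWit μ₁) μ₁) (fun k => dSym (2 * (6 * m + 3)) k (sWit μ₁) μ₁)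
      (balabanFiber (2 * (6 * m + 3)) (by omega) a ha (sWit μ₁) (sWit_zone_ne_zero μ₁).1
        (sWit_zone_ne_zero μ₁).2).G
    - plant 2 (sWit μ₁) (sandwich (fun k => dSym (6 * m + 3) k (sWit μ₁) μ₁)
        (fun k => dSym (6 * m + 3) k (sWit μ₁) μ₁)
        (balabanFiber (6 * m + 3) (by omega) a ha (sWit μ₁) (sWit_zone_ne_zero μ₁).1
          (sWit_zone_ne_zero μ₁).2).G)

/-- the residual statement bounds `‖Xw‖ ≤ C/N`. [folklore] -/
theorem opNorm_Xw_le {a C : ℝ} (h : OrderTwoOpRateResidual d a C) (m : ℕ) [NeZero (6 * m + 3)] (μ₁ : Fin d)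
    (ha : 0 < a) :
    ‖Xw m μ₁ a ha‖ ≤ C / ((6 * m + 3 : ℕ) : ℝ) :=
  h (6 * m + 3) 2 (by omega) (by omega) ha (sWit μ₁) (sWit_zone_ne_zero μ₁).1 (sWit_zone_ne_zero μ₁).2
    μ₁ μ₁ (by norm_num)

/-- **the diagonal witness entry of `Xw`** = `w₂·G^{(2N)}(ιk,ιk)_{μ₁μ₁}·w̄₂ − w₁·G^{(N)}(k,k)_{μ₁μ₁}·w̄₁`.
[folklore] -/
theorem Xw_entry (m : ℕ) [NeZero (6 * m + 3)] (μ₁ μ₂ : Fin d) (a : ℝ) (ha : 0 < a) :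
    Xw m μ₁ a ha (iota 2 (kWit m (6 * m + 3) le_rfl μ₁ μ₂) (sWit μ₁), μ₁)
        (iota 2 (kWit m (6 * m + 3) le_rfl μ₁ μ₂) (sWit μ₁), μ₁)
      = dSym (2 * (6 * m + 3)) (iota 2 (kWit m (6 * m + 3) le_rfl μ₁ μ₂) (sWit μ₁)) (sWit μ₁) μ₁
          * Gfor (2 * (6 * m + 3)) a (sWit μ₁) μ₁ μ₁
              (iota 2 (kWit m (6 * m + 3) le_rfl μ₁ μ₂) (sWit μ₁))
              (iota 2 (kWit m (6 * m + 3) le_rfl μ₁ μ₂) (sWit μ₁))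
          * conj (dSym (2 * (6 * m + 3)) (iota 2 (kWit m (6 * m + 3) le_rfl μ₁ μ₂) (sWit μ₁)) (sWit μ₁) μ₁)
        - dSym (6 * m + 3) (kWit m (6 * m + 3) le_rfl μ₁ μ₂) (sWit μ₁) μ₁
          * Gfor (6 * m + 3) a (sWit μ₁) μ₁ μ₁ (kWit m (6 * m + 3) le_rfl μ₁ μ₂)
              (kWit m (6 * m + 3) le_rfl μ₁ μ₂)
          * conj (dSym (6 * m + 3) (kWit m (6 * m + 3) le_rfl μ₁ μ₂) (sWit μ₁) μ₁) := by
  unfold Xw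
  rw [Matrix.sub_apply, plant_iota_iota (by omega) (sWit_zone_ne_zero μ₁).1]
  simp only [sandwich, G_entry]

end Main

/-! ## §4 NO uniform `ℓ²`-operator η-rate at order two [folklore] -/

section NoGo

variable {μ₁ μ₂ : Fin d}

/-- the junk constant `Cj := ((4d+a)/a·CBa² + (4d/γ₀)·CXa²)/π²` (weighted x/r corrections `≤ Cj/N²`). [folklore] -/
def Cjunk (d : ℕ) (a : ℝ) : ℝ :=
  ((4 * d + a) / a * CBa d ^ 2 + 4 * d / T4GaugeActionRate.gam0 d * CXa d ^ 2) / Real.pi ^ 2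

/-- `Cj ≥ 0`. [folklore] -/
theorem Cjunk_nonneg (d : ℕ) {a : ℝ} (ha : 0 < a) : 0 ≤ Cjunk d a := by
  unfold Cjunk
  have := T4GaugeActionRate.gam0_pos d
  have := CBa_nonneg d
  have := CXa_nonneg d
  positivity

/-- the witness fibre has `p′_{μ₁} = π ≠ 0`. [folklore] -/
theorem sWit_self_ne_zero (μ₁ : Fin d) : sWit μ₁ μ₁ ≠ 0 := by
  simp [sWit, Real.pi_ne_zero]

/-- **level-`N` junk `≤ Cj/N²`.** [folklore] -/
theorem junk_one_le (m : ℕ) [NeZero (6 * m + 3)] (hne : μ₁ ≠ μ₂) (a : ℝ) (ha : 0 < a) :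
    ‖((‖dSym (6 * m + 3) (kWit m (6 * m + 3) le_rfl μ₁ μ₂) (sWit μ₁) μ₁‖ ^ 2 : ℝ) : ℂ)
        * (rEnt (6 * m + 3) a μ₁ μ₁ (sWit μ₁) (kWit m (6 * m + 3) le_rfl μ₁ μ₂)
              (kWit m (6 * m + 3) le_rfl μ₁ μ₂)
            - xEnt (6 * m + 3) a μ₁ (sWit μ₁) (kWit m (6 * m + 3) le_rfl μ₁ μ₂)
              (kWit m (6 * m + 3) le_rfl μ₁ μ₂))‖
      ≤ Cjunk d a / ((6 * m + 3 : ℕ) : ℝ) ^ 2 := by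
  have hs := (sWit_zone_ne_zero μ₁).1
  have hπN : 0 < Real.pi * ((6 * m + 3 : ℕ) : ℝ) := by positivity
  have hw : ‖dSym (6 * m + 3) (kWit m (6 * m + 3) le_rfl μ₁ μ₂) (sWit μ₁) μ₁‖ ^ 2
      ≤ (Real.pi * ((6 * m + 3 : ℕ) : ℝ)) ^ 2 := by
    rw [normSq_w_one m hne]; exact Sxir_qWit_le _ m μ₁ μ₂
  have h := junk_le (by omega) a ha hs μ₁ (sWit_self_ne_zero μ₁) μ₁
    (kWit m (6 * m + 3) le_rfl μ₁ μ₂) _ hπN hw (CXa_nonneg d) (CBa_nonneg d) (xM_w_le m hne μ₁)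
    (bM_w_le m hne a μ₁)
  refine h.trans (le_of_eq ?_)
  rw [Cjunk, div_div, ← mul_pow]

/-- **level-`2N` junk `≤ Cj/N²`.** [folklore] -/
theorem junk_two_le (m : ℕ) [NeZero (6 * m + 3)] (hne : μ₁ ≠ μ₂) (a : ℝ) (ha : 0 < a) :
    ‖((‖dSym (2 * (6 * m + 3)) (iota 2 (kWit m (6 * m + 3) le_rfl μ₁ μ₂) (sWit μ₁)) (sWit μ₁) μ₁‖ ^ 2
          : ℝ) : ℂ)
        * (rEnt (2 * (6 * m + 3)) a μ₁ μ₁ (sWit μ₁)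
              (iota 2 (kWit m (6 * m + 3) le_rfl μ₁ μ₂) (sWit μ₁))
              (iota 2 (kWit m (6 * m + 3) le_rfl μ₁ μ₂) (sWit μ₁))
            - xEnt (2 * (6 * m + 3)) a μ₁ (sWit μ₁)
              (iota 2 (kWit m (6 * m + 3) le_rfl μ₁ μ₂) (sWit μ₁))
              (iota 2 (kWit m (6 * m + 3) le_rfl μ₁ μ₂) (sWit μ₁)))‖
      ≤ Cjunk d a / ((6 * m + 3 : ℕ) : ℝ) ^ 2 := by
  have hs := (sWit_zone_ne_zero μ₁).1
  have hπN : 0 < Real.pi * ((6 * m + 3 : ℕ) : ℝ) := by positivity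
  have hw : ‖dSym (2 * (6 * m + 3)) (iota 2 (kWit m (6 * m + 3) le_rfl μ₁ μ₂) (sWit μ₁)) (sWit μ₁) μ₁‖ ^ 2
      ≤ (Real.pi * ((6 * m + 3 : ℕ) : ℝ)) ^ 2 := by
    rw [normSq_w_two m hne]; exact Sxir_qWit_le _ m μ₁ μ₂
  have hx : xM (2 * (6 * m + 3)) (sWit μ₁) μ₁ (iota 2 (kWit m (6 * m + 3) le_rfl μ₁ μ₂) (sWit μ₁))
      ≤ CXa d / (Real.pi * ((6 * m + 3 : ℕ) : ℝ)) ^ 2 := by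
    rw [xM_iota_w]; exact xM_w_le m hne μ₁
  have hb : bM (2 * (6 * m + 3)) a (sWit μ₁) μ₁ (iota 2 (kWit m (6 * m + 3) le_rfl μ₁ μ₂) (sWit μ₁))
      ≤ CBa d / (Real.pi * ((6 * m + 3 : ℕ) : ℝ)) ^ 2 := by
    rw [bM_iota_w m hne]; exact bM_w_le m hne a μ₁
  have h := junk_le (by omega) a ha hs μ₁ (sWit_self_ne_zero μ₁) μ₁
    (iota 2 (kWit m (6 * m + 3) le_rfl μ₁ μ₂) (sWit μ₁)) _ hπN hw (CXa_nonneg d) (CBa_nonneg d) hx hb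
  refine h.trans (le_of_eq ?_)
  rw [Cjunk, div_div, ← mul_pow]

/-- the arithmetic core: a gap `2/21` between the main terms, junk `≤ Cj/N²` each, and `‖entry‖ ≤ C/N` are
incompatible once `N > 21|C|` and `N > 42·Cj`. [folklore] -/
theorem numeric_core {A₂ A₁ J₂ J₁ : ℂ} {C N Cj : ℝ} (hN : 0 < N) (h1N : 1 ≤ N) (hCj : 0 ≤ Cj)
    (hent : ‖(A₂ + J₂) - (A₁ + J₁)‖ ≤ C / N) (hA : ‖A₂ - A₁‖ = 2 / 21) (hJ2 : ‖J₂‖ ≤ Cj / N ^ 2)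
    (hJ1 : ‖J₁‖ ≤ Cj / N ^ 2) (hC : 21 * |C| < N) (hJ : 42 * Cj < N) : False := by
  have hsplit : (A₂ + J₂) - (A₁ + J₁) = (A₂ - A₁) + (J₂ - J₁) := by ring
  rw [hsplit] at hent
  have h3 : ‖A₂ - A₁‖ ≤ ‖(A₂ - A₁) + (J₂ - J₁)‖ + ‖J₂ - J₁‖ := by
    simpa only [add_sub_cancel_right] using norm_sub_le ((A₂ - A₁) + (J₂ - J₁)) (J₂ - J₁)
  have h4 : ‖J₂ - J₁‖ ≤ Cj / N ^ 2 + Cj / N ^ 2 := (norm_sub_le _ _).trans (add_le_add hJ2 hJ1)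
  rw [hA] at h3
  have h5 : C / N ≤ |C| / N := div_le_div_of_nonneg_right (le_abs_self C) hN.le
  have h6 : |C| / N < 1 / 21 := by rw [div_lt_iff₀ hN]; linarith
  have h7 : Cj / N ^ 2 ≤ Cj / N := div_le_div_of_nonneg_left hCj hN (by nlinarith)
  have h8 : Cj / N < 1 / 42 := by rw [div_lt_iff₀ hN]; linarith
  linarith

/-- **NO UNIFORM `ℓ²`-OPERATOR η-RATE AT ORDER TWO (operator level).** For every `d ≥ 2` (two distinct
directions `μ₁ ≠ μ₂`), every `a > 0` and EVERY constant `C`, the naive order-two residual statement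
`OrderTwoOpRateResidual d a C` — a uniform `C/N` bound for the `ℓ²`-operator norm of the planted difference of
the sandwiches `D_{∂_ν}G D^*_{∂_{ν′}}` between the levels `N` and `RN` — is FALSE. Witness: `R = 2`,
`N = 6m + 3` large, fibre `p′ = π e_{μ₁}`, `ν = ν′ = μ₁`, the diagonal entry at the class `k` with physical
momentum `q = 2πk + p′ = (πN) e_{μ₁} + (2πN/3) e_{μ₂}`: its main (free-diagonal) part is `2/3 − 4/7 = 2/21`
(`B5G183RateObstruction.weight_level`, `weight_level_double`), its x/r corrections are `≤ 2·Cj/N²`, and an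
entry is bounded by the operator norm. (This is the operator-level form of the symbol-level obstruction
`B5G183RateObstruction.order_two_weight_no_rate`; it says the order-two item of (1.89) has NO η-rate in this
norm uniformly in the class — any order-two rate statement must change the norm or the regime.) [folklore] -/
theorem not_orderTwoOpRateResidual (hne : μ₁ ≠ μ₂) (a : ℝ) (ha : 0 < a) (C : ℝ) :
    ¬ OrderTwoOpRateResidual d a C := by
  intro h
  have hCj := Cjunk_nonneg d ha
  obtain ⟨m, hm⟩ := exists_nat_ge (21 * |C| + 42 * Cjunk d a)
  haveI : NeZero (6 * m + 3) := ⟨by omega⟩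
  have hNm : (m : ℝ) + 3 ≤ ((6 * m + 3 : ℕ) : ℝ) := by
    push_cast; linarith [(Nat.cast_nonneg m : (0 : ℝ) ≤ m)]
  have hN1 : (1 : ℝ) ≤ ((6 * m + 3 : ℕ) : ℝ) := by exact_mod_cast (show 1 ≤ 6 * m + 3 by omega)
  have hNpos : (0 : ℝ) < ((6 * m + 3 : ℕ) : ℝ) := by positivity
  have hC : 21 * |C| < ((6 * m + 3 : ℕ) : ℝ) := by linarith [abs_nonneg C]
  have hJ : 42 * Cjunk d a < ((6 * m + 3 : ℕ) : ℝ) := by linarith [abs_nonneg C]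
  have hent := (norm_apply_le_norm (Xw m μ₁ a ha)
    (iota 2 (kWit m (6 * m + 3) le_rfl μ₁ μ₂) (sWit μ₁), μ₁)
    (iota 2 (kWit m (6 * m + 3) le_rfl μ₁ μ₂) (sWit μ₁), μ₁)).trans (opNorm_Xw_le h m μ₁ ha)
  rw [Xw_entry m μ₁ μ₂ a ha, Gfor_diag, Gfor_diag, weight_mul_diag, weight_mul_diag] at hent
  have hm2 := main_two m hne
  have hm1 := main_one m hne
  refine numeric_core hNpos hN1 hCj hent ?_ (junk_two_le m hne a ha) (junk_one_le m hne a ha) hC hJ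
  rw [← Complex.ofReal_inv, ← Complex.ofReal_inv, ← Complex.ofReal_mul, ← Complex.ofReal_mul,
    ← Complex.ofReal_sub, Complex.norm_real, Real.norm_eq_abs, ← div_eq_mul_inv, ← div_eq_mul_inv, hm2, hm1]
  norm_num

/-- hence no constant works: `¬ ∃ C, OrderTwoOpRateResidual d a C` (`d ≥ 2`, `a > 0`). [folklore] -/
theorem no_orderTwoOpRate (hne : μ₁ ≠ μ₂) (a : ℝ) (ha : 0 < a) : ¬ ∃ C, OrderTwoOpRateResidual d a C :=
  fun ⟨C, hC⟩ => not_orderTwoOpRateResidual hne a ha C hC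

end NoGo

end Literature.MathematicalPhysics.QuantumFieldTheory.Balaban1983to89.B5G183RateObstructionOp

end
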